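import Mathlib
import Summits.KontsevichZagierPeriods.Zeta5Search.TopRelationDOne
import Summits.KontsevichZagierPeriods.Zeta5Search.Elimination.PencilGauge
import HarnessLib

/-!
# The ρ-free PENCIL at the `d`-interface: wedge form and gauge (cell `pub-zeta5`, ct-1 g24)

HONEST FRAMING: systematic search; no irrationality claim unless certified.  Identities among the cell's rational dictionary data
(`U = coeffU`, `W = coeffW` — the canonical coefficients of the dual very-well-poised series — and the proved gauge `ρ = rhoB`);
no integral is evaluated, nothing about sizes, denominators or ζ(5); records in print UNMOVED.

OUR work (Summit side; seat `pub-zeta5-ct-1` generation 24, 2026-08-26).  fam-elim E-L17's ρ-free pencil (`pencil_perm`) relates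
the slot wedges at the base `c`, the apex `c⁺ = c + DS` and `c⁺ − e_i`, under `d(c − e_i) ≥ 2`.  At the `d`-INTERFACE `d(c) = 0`
(so `d(c⁺) = −1`) its third coefficient has the factor `d(c − e_i) − 1 = 0` and the relation becomes TWO-TERM.  This file proves
that two-term law directly from the frame relations that do hold there — (DS) (`coeffU/W_dsShift` at `x = c − e_i` and at `c`)
and ct-1 g24's three-term top relation at `d = 1` along the slot `i` (`top_threeTerm_dOne_slot` at `x`) — by 2×2 determinant
algebra and the scalar identity `lawD_scalar_identity` (`TopRelationDOne`):

* **`lawD_wedge`** — for `x` in the box with `d(x) = 1`, `x_i + 1 ≤ N` (`i = s+1`) and `R ≠ 0`: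
  `L·W_i(c) = R·W_i(x⁺)`, `c = x + e_i`, `W_i(y) = U(y)W(y+e_i) − U(y+e_i)W(y)`, `L = ∏_{k≠i}(x_k + 1)`,
  `R = ∏_{k≠i}(N − x_i − x_k)` (products written over `k < 6` through `σ•x`, `σ = (s 6)`); exact check before formalisation
  (seat folder `code/lawd_derive.py`, slot 2, levels `≤ 5`): the wedge identity and its scalar at every instance, 0 failures;
* **`rhoB_dZero_gauge`** — the gauge of the move `c ↦ c⁺ − e_i` at `d(c) = 0` (E-L18's `rhoB_lower` at `c` composed with
  `rhoB_dsShift` at `x`): `ρ(x⁺)·∏_{j∈{1,4,5,6,7}}(x_j + 1)·χ_i(c) = c_i·edgeProd(c, i)·ρ(c)`;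
* `lawD_gauge_identity_base`, `lawD_gauge_identity_fan` — the two per-slot polynomial identities that dress `lawD_wedge` with the
  PENCIL coefficients: `pencilBase(c)·∏(x_j+1)·χ_i(c) = −c_i·χ_i(c⁺)·L` and `fanCoeff(c⁺, i)·edgeProd(c, i) = χ_i(c⁺)·R`.
Use (ct-1 g24, next file `QPencilDInterface`): the `d`-interface PENCIL law for Brown–Zudilin's leading coefficient `Q`.
-/

noncomputable section

open Finset

namespace Summit.KontsevichZagierPeriods.Zeta5Search.WedgeDictionary

open Summit.KontsevichZagierPeriods.Zeta5Search.DualSeries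
open Summit.KontsevichZagierPeriods.Zeta5Search.SymmetricGauge (permLower rhoB dOf_permLower)
open Summit.KontsevichZagierPeriods.Zeta5Search.Elimination (permLower_vals permLower_swap6_apply bump_dsShift_slot rhoB_lower
  rhoB_dsShift edgeProd dsShift_apply)

/-! ### 1. The ρ-free pencil at the `d`-interface (wedge form) -/

set_option maxHeartbeats 800000 in
/-- **The ρ-free PENCIL at the `d`-interface.**  For `x` in the box with `d(x) = 1`, slot `i = s+1` with `x_i + 1 ≤ N`, `c = x + e_i`,
`x⁺ = x + DS`, and the slot-`i` wedges `W_i(y) = U(y)W(y+e_i) − U(y+e_i)W(y)`: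
`(∏_{k≠i}(x_k+1))·W_i(c) = (∏_{k≠i}(N − x_i − x_k))·W_i(x⁺)` provided the second product is non-zero
(the products are written over `k < 6` through `σ•x`, `σ = (s 6)`: `(σ•x)_{k+1}`, `k < 6`, runs over the slots `≠ i`). -/
theorem lawD_wedge (x : ℕ → ℤ) (s : Fin 7) (hx : InBox x) (hd : dOf x = 1) (hs : x (s.val + 1) + 1 ≤ x 0)
    (hR : (∏ k ∈ range 6, ((x 0 : ℚ) - x (s.val + 1) - permLower (Equiv.swap s 6) x (k + 1))) ≠ 0) :
    (∏ k ∈ range 6, ((permLower (Equiv.swap s 6) x (k + 1) : ℚ) + 1)) *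
        (coeffU (bump x s.val) * coeffW (bump (bump x s.val) s.val) -
          coeffU (bump (bump x s.val) s.val) * coeffW (bump x s.val)) =
      (∏ k ∈ range 6, ((x 0 : ℚ) - x (s.val + 1) - permLower (Equiv.swap s 6) x (k + 1))) *
        (coeffU (dsShift x) * coeffW (bump (dsShift x) s.val) -
          coeffU (bump (dsShift x) s.val) * coeffW (dsShift x)) := by
  have hs7 : s.val < 7 := s.isLt
  have hsr : s.val ∈ range 7 := mem_range.2 hs7
  -- the relabelled vector `b = σ • x`
  have hσ6 : (Equiv.swap s 6 : Equiv.Perm (Fin 7)) 6 = s := Equiv.swap_apply_right _ _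
  obtain ⟨hb0, -, -, -, -, -, -, hb7⟩ := permLower_vals (Equiv.swap s 6) x
  rw [hσ6] at hb7
  have hbd : dOf (permLower (Equiv.swap s 6) x) = 1 := by rw [dOf_permLower]; exact hd
  -- (T) the three-term top relation along the slot, (S) the scalar identity, (G0) the closed form of γ₀
  obtain ⟨TU, TW⟩ := top_threeTerm_dOne_slot x s hx hd hs
  have hS := lawD_scalar_identity (permLower (Equiv.swap s 6) x) hbd
  have hG0 := topGamma0_eq (permLower (Equiv.swap s 6) x)
  rw [hb0, hb7] at hS hG0
  -- (DS) at `x` and at `c = x + e_i`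
  have hc0 : bump x s.val 0 = x 0 := bump_zero x s.val
  have hcs : bump x s.val (s.val + 1) = x (s.val + 1) + 1 := bump_self x s.val
  have hcI : InBox (bump x s.val) := inBox_update x hx hsr (by omega)
  have hdc : dOf (bump x s.val) = 0 := by rw [dOf_bump x hsr, hd]; norm_num
  have DUx := coeffU_dsShift x hx (by omega) hsr (by omega)
  have DWx := coeffW_dsShift x hx (by omega) hsr (by omega)
  have DUc := coeffU_dsShift (bump x s.val) hcI (by omega) hsr (by rw [hcs, hc0]; omega)
  have DWc := coeffW_dsShift (bump x s.val) hcI (by omega) hsr (by rw [hcs, hc0]; omega)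
  change coeffU (dsShift x) = coeffU (bump x s.val) - dsLam x s.val * coeffU x at DUx
  change coeffW (dsShift x) = coeffW (bump x s.val) - dsLam x s.val * coeffW x at DWx
  change coeffU (dsShift (bump x s.val)) = coeffU (bump (bump x s.val) s.val) -
    dsLam (bump x s.val) s.val * coeffU (bump x s.val) at DUc
  change coeffW (dsShift (bump x s.val)) = coeffW (bump (bump x s.val) s.val) -
    dsLam (bump x s.val) s.val * coeffW (bump x s.val) at DWc
  rw [bump_dsShift_slot, DUx, DWx, DUc, DWc]
  -- the explicit scalars
  have hlam : dsLam x s.val = ((x (s.val + 1) : ℚ) + 1) * ((x 0 : ℚ) - x (s.val + 1) + 1) := rfl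
  have hlamc : dsLam (bump x s.val) s.val = ((x (s.val + 1) : ℚ) + 2) * ((x 0 : ℚ) - x (s.val + 1)) := by
    unfold dsLam; rw [hcs, hc0]; push_cast; ring
  rw [hlam, hlamc]
  -- abbreviations
  set γ0 := topGamma0 (permLower (Equiv.swap s 6) x) with hγ0
  set γ1 := topGamma1 (permLower (Equiv.swap s 6) x) with hγ1
  set γ2 := topGamma2 (permLower (Equiv.swap s 6) x) with hγ2
  set L := ∏ k ∈ range 6, ((permLower (Equiv.swap s 6) x (k + 1) : ℚ) + 1) with hL
  set R := ∏ k ∈ range 6, ((x 0 : ℚ) - x (s.val + 1) - permLower (Equiv.swap s 6) x (k + 1)) with hRdef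
  set ux := coeffU x
  set uc := coeffU (bump x s.val)
  set uce := coeffU (bump (bump x s.val) s.val)
  set wx := coeffW x
  set wc := coeffW (bump x s.val)
  set wce := coeffW (bump (bump x s.val) s.val)
  set β : ℚ := (x (s.val + 1) : ℚ) with hβ
  set N : ℚ := (x 0 : ℚ) with hN
  -- (E1), (E3): wedging the top relation with `f(c)` and `f(c + e_i)`
  have E1 : γ2 * (uc * wce - uce * wc) - γ0 * (ux * wc - uc * wx) = 0 := by
    linear_combination uc * TW - wc * TU
  have E3 : γ1 * (uc * wce - uce * wc) + γ0 * (ux * wce - uce * wx) = 0 := by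
    linear_combination wce * TU - uce * TW
  -- the key identity `(β+1)·R·(L·W(c) − R·W(x⁺)) = 0`
  have key : (β + 1) * R * (L * (uc * wce - uce * wc) -
      R * ((uc - (β + 1) * (N - β + 1) * ux) * (wce - (β + 2) * (N - β) * wc) -
        (uce - (β + 2) * (N - β) * uc) * (wc - (β + 1) * (N - β + 1) * wx))) = 0 := by
    rw [hG0] at E1 E3
    linear_combination (R * ((β + 1) * (N - β + 1)) * ((β + 2) * (N - β))) * E1 +
      (R * ((β + 1) * (N - β + 1))) * E3 + ((β + 1) * R * (uc * wce - uce * wc)) * hS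
  have hβ1 : (β + 1) ≠ 0 := by
    have : (0 : ℚ) ≤ β := by rw [hβ]; exact_mod_cast (hx.2 s.val hsr).1
    exact ne_of_gt (by linarith)
  have h3 := mul_eq_zero.1 key
  rcases h3 with h | h
  · exact absurd h (mul_ne_zero hβ1 hR)
  · linear_combination h

/-! ### 2. The gauge of the move `c ↦ c⁺ − e_i` at `d(c) = 0` -/

/-- **The gauge across the `d`-interface.**  For `c` in the box with `d(c) = 0`, `c_i ≥ 1` (`i = s+1`) and the fifteen edge pairs
`≤ N`, with `x = c − e_i` (so `d(x) = 1`): `ρ(x⁺)·∏_{j∈{1,4,5,6,7}}(x_j + 1)·χ_i(c) = c_i·edgeProd(c, i)·ρ(c)` — E-L18's `rhoB_lower`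
at `c` (where `d(c) + 1 = 1`) composed with `rhoB_dsShift` at `x` (where `d(x) = 1`). -/
theorem rhoB_dZero_gauge (c : ℕ → ℤ) (s : Fin 7) (hc : InBox c) (hd : dOf c = 0) (hi : 1 ≤ c (s.val + 1))
    (hE : ∀ jk ∈ Epairs, c jk.1 + c jk.2 ≤ c 0) :
    rhoB (dsShift (Function.update c (s.val + 1) (c (s.val + 1) - 1))) *
        ((([1, 4, 5, 6, 7] : List ℕ).map fun j => ((Function.update c (s.val + 1) (c (s.val + 1) - 1) j : ℚ) + 1)).prod) *
        (chiOf c (s.val + 1) : ℚ) =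
      (c (s.val + 1) : ℚ) * edgeProd c (s.val + 1) * rhoB c := by
  set x := Function.update c (s.val + 1) (c (s.val + 1) - 1) with hx
  have x0 : x 0 = c 0 := Function.update_of_ne (by omega) _ _
  have xs : x (s.val + 1) = c (s.val + 1) - 1 := Function.update_self _ _ _
  have xk : ∀ k, k ≠ s.val + 1 → x k = c k := fun k hk => Function.update_of_ne hk _ _
  have hxI : InBox x := by
    refine ⟨by rw [x0]; exact hc.1, fun j hj => ?_⟩
    by_cases h : j + 1 = s.val + 1
    · rw [h, xs, x0]; have := hc.2 s.val (mem_range.2 s.isLt); omega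
    · rw [xk _ h, x0]; exact hc.2 j hj
  have hdx : dOf x = 1 := by
    have e : ∀ j ∈ range 7, x (j + 1) = c (j + 1) + (if j = s.val then -1 else 0) := fun j _ => by
      split_ifs with h
      · rw [h, xs]; ring
      · rw [xk _ (by omega)]; ring
    unfold dOf at hd ⊢
    rw [sum_congr rfl e, sum_add_distrib, sum_ite_eq' (range 7) s.val (fun _ => (-1 : ℤ)),
      if_pos (mem_range.2 s.isLt), x0]
    omega
  have h1 := rhoB_lower c s.isLt hc hi (by omega) hE
  have h2 := rhoB_dsShift x hxI (by omega)
  rw [hd, ← hx] at h1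
  rw [hdx] at h2
  push_cast at h1 h2
  -- `ρ(x⁺)·Π = −ρ(x)` and `ρ(x)·χ = −c_i·edgeProd·ρ(c)`
  linear_combination (chiOf c (s.val + 1) : ℚ) * h2 - h1

/-! ### 3. The two per-slot identities -/

/-- Per-slot identity (a): `pencilBase(c)·∏_{j∈{1,4,5,6,7}}(x_j+1)·χ_i(c) = −c_i·χ_i(c⁺)·L`, `x = c − e_i`,
`L = ∏_{k≠i}(x_k + 1)` (through `σ•x`). -/
theorem lawD_gauge_identity_base (c : ℕ → ℤ) (s : Fin 7) :
    (pencilBase c : ℚ) *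
          ((([1, 4, 5, 6, 7] : List ℕ).map fun j => ((Function.update c (s.val + 1) (c (s.val + 1) - 1) j : ℚ) + 1)).prod) *
          (chiOf c (s.val + 1) : ℚ) =
      -((c (s.val + 1) : ℚ) * (chiOf (dsShift c) (s.val + 1) : ℚ) *
        ∏ k ∈ range 6, ((permLower (Equiv.swap s 6) (Function.update c (s.val + 1) (c (s.val + 1) - 1)) (k + 1) : ℚ) + 1)) := by
  fin_cases s <;>
  · simp only [pencilBase, chiOf, List.map_cons, List.map_nil, List.prod_cons, List.prod_nil, prod_range_succ, prod_range_zero,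
      permLower_swap6_apply, dsShift_apply, Function.update_apply]
    norm_num
    ring

/-- Per-slot identity (b): `fanCoeff(c⁺, i)·edgeProd(c, i) = χ_i(c⁺)·R`, `R = ∏_{k≠i}(N − x_i − x_k)`, `x = c − e_i` (through `σ•x`):
the non-edge and the edge partners of `i` together are all the slots `≠ i`. -/
theorem lawD_gauge_identity_fan (c : ℕ → ℤ) (s : Fin 7) :
    (fanCoeff (dsShift c) (s.val + 1) : ℚ) * edgeProd c (s.val + 1) =
      (chiOf (dsShift c) (s.val + 1) : ℚ) *
        ∏ k ∈ range 6, ((c 0 : ℚ) - (Function.update c (s.val + 1) (c (s.val + 1) - 1)) (s.val + 1) -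
          permLower (Equiv.swap s 6) (Function.update c (s.val + 1) (c (s.val + 1) - 1)) (k + 1)) := by
  fin_cases s <;>
  · simp only [fanCoeff, chiOf, nonEdgePartners, edgeProd, Epairs, List.map_cons, List.map_nil, List.prod_cons, List.prod_nil,
      prod_range_succ, prod_range_zero, permLower_swap6_apply, dsShift_apply, Function.update_apply]
    norm_num
    ring

end Summit.KontsevichZagierPeriods.Zeta5Search.WedgeDictionary

end
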